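import Mathlib
import HarnessLib

/-!
# The number field generated by finitely many algebraic numbers: denominators, sizes, norms

Topic: `Literature/NumberTheory/Transcendental`. Generic arithmetic set-up of Baker's method
(plan item W4(c)/(f) of the unit `provefact-Literature.NumberTheory.Transcendental.H-b596640137`),
extracted from the pattern of `BakerLogarithmsField.lean` (there tied to Baker's `Setup`) so that
any transcendence proof in the tree can use it: for a finite family `a : ι → ℂ` of algebraic
numbers (`AlgGens`),

* `AlgGens.K` — the number field `K = ℚ(aᵢ : i ∈ ι) ⊆ ℂ` (`IntermediateField.adjoin`), with its
  `NumberField` instance, and the generators `AlgGens.genK i : K`;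
* `AlgGens.exists_den` / `AlgGens.den` — a common denominator `d ≠ 0`, `d·aᵢ ∈ 𝓞 K`, and
  `AlgGens.isIntegral_den_pow_mul_aeval` — `d^e · P(a)` is an algebraic integer for every
  integer polynomial `P` of total degree `≤ e`;
* `AlgGens.M`, `AlgGens.norm_embedding_genK_le` — a bound `M ≥ 1` for all conjugates of all
  generators, and `AlgGens.norm_embedding_aeval_le` — `|σ(P(a))| ≤ ‖P‖₁ · M^e`;
* `AlgGens.h` — the number of complex embeddings (`= [K : ℚ]`);
* `AlgGens.house_le_of_forall_norm_le` and the **Liouville inequality**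
  `AlgGens.one_le_norm_mul_house_pow` — a non-zero algebraic integer `x ∈ 𝓞 K` satisfies
  `1 ≤ |x| · house(x)^{h-1}` (the norm of `x` is a non-zero rational integer; Mathlib's
  `NumberField.norm_norm_le_norm_mul_house_pow`).

Siegel's lemma over `𝓞 K` is Mathlib's `NumberField.house.exists_ne_zero_int_vec_house_le`; it
consumes exactly the integrality (`isIntegral_den_pow_mul_aeval`) and size
(`norm_embedding_aeval_le`, through `house_le_of_forall_norm_le`) statements above. Everything is
proved; sources: Baker 1975, Ch. 2, Lemma 3 (the pattern), folklore otherwise.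

## References

* A. Baker, *Transcendental Number Theory*, CUP 1975, Ch. 2, Lemmas 1–3.
* A. Baker, G. Wüstholz, *Logarithmic Forms and Diophantine Geometry*, CUP 2007, §6.8
  (Siegel's lemma, Liouville-type estimate).
-/

noncomputable section

open Complex Finset NumberField MvPolynomial

namespace Literature.NumberTheory.Transcendental

/-- A finite family of algebraic complex numbers (the algebraic data of a transcendence proof:
coefficients, coordinates of the algebraic points, …). [folklore] -/
structure AlgGens where
  /-- the (finite) index type -/
  ι : Type
  /-- finiteness of the index type -/
  [fin : Fintype ι]
  /-- the generators -/
  a : ι → ℂ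
  /-- they are algebraic -/
  alg : ∀ i, IsAlgebraic ℚ (a i)

namespace AlgGens

/-- The index type of an `AlgGens` is finite (the structure field, as an instance on the new
type `G.ι`; it overrides nothing). [folklore] -/
instance instFintypeι (G : AlgGens) : Fintype G.ι := G.fin

variable (G : AlgGens)

/-! ### The number field `K = ℚ(aᵢ)` -/

/-- The number field `K = ℚ(aᵢ : i ∈ ι) ⊆ ℂ`. [folklore] -/
def K : IntermediateField ℚ ℂ := IntermediateField.adjoin ℚ (Set.range G.a)

/-- `K/ℚ` is finite. [folklore] -/
instance finiteDimensional_K : FiniteDimensional ℚ G.K := by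
  haveI : Finite (Set.range G.a) := (Set.finite_range _).to_subtype
  exact IntermediateField.finiteDimensional_adjoin fun x hx => by
    obtain ⟨i, rfl⟩ := hx
    exact (G.alg i).isIntegral

/-- `K` is a number field. [folklore] -/
instance numberField_K : NumberField G.K :=
  { to_charZero := charZero_of_injective_algebraMap (algebraMap ℚ G.K).injective
    to_finiteDimensional := G.finiteDimensional_K }

/-- The generators lie in `K`. [folklore] -/
theorem a_mem_K (i : G.ι) : G.a i ∈ G.K := IntermediateField.subset_adjoin _ _ ⟨i, rfl⟩

/-- `aᵢ` as an element of `K`. [folklore] -/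
def genK (i : G.ι) : G.K := ⟨G.a i, G.a_mem_K i⟩

/-- `(genK i : ℂ) = aᵢ`. [folklore] -/
@[simp] theorem coe_genK (i : G.ι) : (G.genK i : ℂ) = G.a i := rfl

/-- `algebraMap K ℂ (genK i) = aᵢ`. [folklore] -/
@[simp] theorem algebraMap_genK (i : G.ι) : algebraMap G.K ℂ (G.genK i) = G.a i := rfl

/-! ### A common denominator -/

/-- **A common denominator**: a non-zero integer `d` with `d · aᵢ ∈ 𝓞 K` for all `i`.
[cite: Baker1975, Ch. 2 §3 (eq. (2): leading coefficients as denominators)] -/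
theorem exists_den : ∃ d : ℤ, d ≠ 0 ∧ ∀ i, IsIntegral ℤ ((d : G.K) * G.genK i) := by
  have h1 : ∀ i, ∃ y : ℤ, y ≠ 0 ∧ IsIntegral ℤ ((y : G.K) * G.genK i) := by
    intro i
    have hQ : IsAlgebraic ℚ (G.genK i) := Algebra.IsAlgebraic.isAlgebraic _
    have hz : IsAlgebraic ℤ (G.genK i) := (IsFractionRing.isAlgebraic_iff ℤ ℚ G.K).mpr hQ
    obtain ⟨y, hy, hint⟩ := hz.exists_integral_multiple
    exact ⟨y, hy, by simpa [zsmul_eq_mul] using hint⟩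
  choose y hy hint using h1
  classical
  refine ⟨∏ i, y i, prod_ne_zero_iff.mpr fun i _ => hy i, fun i => ?_⟩
  rw [← mul_prod_erase univ y (mem_univ i)]
  push_cast
  rw [mul_comm ((y i : G.K)) _, mul_assoc]
  have h2 : IsIntegral ℤ (((∏ j ∈ univ.erase i, y j : ℤ) : G.K)) := by
    exact_mod_cast isIntegral_algebraMap (R := ℤ) (A := G.K) (x := ∏ j ∈ univ.erase i, y j)
  simpa using h2.mul (hint i)

/-- The common denominator `d ≠ 0`. [folklore] -/
def den : ℤ := G.exists_den.choose

/-- `d ≠ 0`. [folklore] -/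
theorem den_ne_zero : G.den ≠ 0 := G.exists_den.choose_spec.1

/-- `d · aᵢ` is an algebraic integer. [folklore] -/
theorem isIntegral_den_mul_genK (i : G.ι) : IsIntegral ℤ ((G.den : G.K) * G.genK i) :=
  G.exists_den.choose_spec.2 i

/-- `1 ≤ |d|`. [folklore] -/
theorem one_le_abs_den : (1 : ℝ) ≤ |(G.den : ℝ)| := by exact_mod_cast Int.one_le_abs G.den_ne_zero

/-- Integers are algebraic integers of `K`. [folklore] -/
theorem isIntegral_intCast_K (k : ℤ) : IsIntegral ℤ (k : G.K) := by
  exact_mod_cast isIntegral_algebraMap (R := ℤ) (A := G.K) (x := k)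

/-- **Clearing denominators in polynomial expressions**: for an integer polynomial `P` of total
degree `≤ e`, `d^e · P(a)` is an algebraic integer of `K`. [cite: Baker1975, Ch. 2 Lemma 2 (eq. (6): P' = (denominators)^{…} · P)] -/
theorem isIntegral_den_pow_mul_aeval (P : MvPolynomial G.ι ℤ) {e : ℕ} (he : P.totalDegree ≤ e) :
    IsIntegral ℤ ((G.den : G.K) ^ e * aeval G.genK P) := by
  classical
  rw [P.as_sum, map_sum, mul_sum]
  refine IsIntegral.sum _ fun m hm => ?_
  rw [aeval_monomial, mul_left_comm]
  refine IsIntegral.mul isIntegral_algebraMap ?_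
  -- `d^e ∏ (genK i)^{m i} = d^{e - |m|} ∏ (d genK i)^{m i}`
  have hdeg : m.sum (fun _ k => k) ≤ e := (le_totalDegree hm).trans he
  have hdeg' : ∑ i ∈ m.support, m i ≤ e := by simpa [Finsupp.sum] using hdeg
  have e1 : (G.den : G.K) ^ e * ∏ i ∈ m.support, G.genK i ^ m i =
      (G.den : G.K) ^ (e - ∑ i ∈ m.support, m i) *
        ∏ i ∈ m.support, ((G.den : G.K) * G.genK i) ^ m i := by
    rw [prod_congr rfl (fun i _ => mul_pow (G.den : G.K) (G.genK i) (m i)), prod_mul_distrib,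
      prod_pow_eq_pow_sum, ← mul_assoc, ← pow_add, Nat.sub_add_cancel hdeg']
  rw [Finsupp.prod, e1]
  refine ((G.isIntegral_intCast_K _).pow _).mul ?_
  exact IsIntegral.prod _ fun i _ => (G.isIntegral_den_mul_genK i).pow _

/-! ### Sizes of conjugates -/

/-- **A bound for the conjugates of the generators**: `M = 1 + ∑_σ ∑_i |σ aᵢ| ≥ 1`.
[cite: Baker1975, Ch. 2 Lemma 3] -/
def M : ℝ := 1 + ∑ σ : G.K →+* ℂ, ∑ i, ‖σ (G.genK i)‖

/-- `1 ≤ M`. [folklore] -/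
theorem one_le_M : 1 ≤ G.M := by
  have : 0 ≤ ∑ σ : G.K →+* ℂ, ∑ i, ‖σ (G.genK i)‖ := by positivity
  unfold M; linarith

/-- Every conjugate of every generator has absolute value at most `M`. [folklore] -/
theorem norm_embedding_genK_le (σ : G.K →+* ℂ) (i : G.ι) : ‖σ (G.genK i)‖ ≤ G.M := by
  have h1 : ‖σ (G.genK i)‖ ≤ ∑ i', ‖σ (G.genK i')‖ :=
    single_le_sum (f := fun i' => ‖σ (G.genK i')‖) (fun _ _ => norm_nonneg _) (mem_univ i)
  have h2 : ∑ i', ‖σ (G.genK i')‖ ≤ ∑ τ : G.K →+* ℂ, ∑ i', ‖τ (G.genK i')‖ :=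
    single_le_sum (f := fun τ : G.K →+* ℂ => ∑ i', ‖τ (G.genK i')‖) (fun _ _ => by positivity)
      (mem_univ σ)
  unfold M; linarith

/-- **Size of the conjugates of a polynomial expression**: for an integer polynomial `P` of
total degree `≤ e` and any embedding `σ`, `|σ(P(a))| ≤ (∑ |coefficients|) · M^e`.
[cite: Baker1975, Ch. 2 Lemma 3 ("any conjugate of f' … has absolute value at most c₁₀^{h²+Ll}")] -/
theorem norm_embedding_aeval_le (σ : G.K →+* ℂ) (P : MvPolynomial G.ι ℤ) {e : ℕ}
    (he : P.totalDegree ≤ e) :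
    ‖σ (aeval G.genK P)‖ ≤ (∑ m ∈ P.support, |((P.coeff m : ℤ) : ℝ)|) * G.M ^ e := by
  classical
  have hM := G.one_le_M
  have hP : aeval G.genK P = ∑ m ∈ P.support, aeval G.genK (monomial m (P.coeff m)) := by
    conv_lhs => rw [P.as_sum]
    rw [map_sum]
  rw [hP, map_sum, sum_mul]
  refine (norm_sum_le _ _).trans (sum_le_sum fun m hm => ?_)
  rw [aeval_monomial, map_mul, norm_mul]
  have hc : ‖σ (algebraMap ℤ G.K (P.coeff m))‖ = |((P.coeff m : ℤ) : ℝ)| := by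
    rw [eq_intCast, map_intCast, Complex.norm_intCast]
  rw [hc]
  refine mul_le_mul_of_nonneg_left ?_ (abs_nonneg _)
  -- `|σ(∏ genK^{m i})| ≤ M^{|m|} ≤ M^e`
  have hdeg : m.sum (fun _ k => k) ≤ e := (le_totalDegree hm).trans he
  rw [Finsupp.prod, map_prod, norm_prod]
  calc ∏ i ∈ m.support, ‖σ (G.genK i ^ m i)‖ ≤ ∏ i ∈ m.support, G.M ^ m i := by
        refine prod_le_prod (fun i _ => norm_nonneg _) fun i _ => ?_
        rw [map_pow, norm_pow]
        exact pow_le_pow_left₀ (norm_nonneg _) (G.norm_embedding_genK_le σ i) _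
    _ = G.M ^ m.sum (fun _ k => k) := by rw [Finsupp.sum, prod_pow_eq_pow_sum]
    _ ≤ G.M ^ e := pow_le_pow_right₀ hM hdeg

/-! ### Embeddings, house and the Liouville inequality -/

/-- The number of complex embeddings of `K` (`= [K : ℚ]`). [folklore] -/
def h : ℕ := Fintype.card (G.K →+* ℂ)

/-- `1 ≤ h`. [folklore] -/
theorem one_le_h : 1 ≤ G.h := Fintype.card_pos

/-- `h = [K : ℚ]`. [folklore] -/
theorem finrank_eq_h : Module.finrank ℚ G.K = G.h := (Embeddings.card G.K ℂ).symm

/-- `house x ≤ B` from a bound on all conjugates. [folklore] -/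
theorem house_le_of_forall_norm_le {x : G.K} {B : ℝ} (hB : 0 ≤ B)
    (hx : ∀ σ : G.K →+* ℂ, ‖σ x‖ ≤ B) : house x ≤ B := by
  rw [house, pi_norm_le_iff_of_nonneg hB]
  intro σ
  exact hx σ

/-- **The Liouville (norm) inequality**: a non-zero algebraic integer `x` of `K` satisfies
`1 ≤ |x| · house(x)^{h-1}` — the norm of `x` is a non-zero rational integer and is the product of
`|x|` with the other conjugates (Baker 1975, p. 23: "the norm of f' has absolute value at least
1"; Baker–Wüstholz 2007, p. 119: "a Liouville-type estimate"). [cite: Baker1975, Ch. 2 Lemma 3] -/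
theorem one_le_norm_mul_house_pow {x : 𝓞 G.K} (hx : x ≠ 0) :
    1 ≤ ‖((x : G.K) : ℂ)‖ * house (x : G.K) ^ (G.h - 1) := by
  have h0 := NumberField.norm_norm_le_norm_mul_house_pow (x : G.K) (algebraMap G.K ℂ)
  have h1 : (1 : ℝ) ≤ ‖Algebra.norm ℚ (x : G.K)‖ := by
    rw [← Algebra.coe_norm_int]
    have hn : Algebra.norm ℤ x ≠ 0 := Algebra.norm_ne_zero_iff.mpr hx
    rw [Int.norm_cast_rat, Int.norm_eq_abs]
    exact_mod_cast Int.one_le_abs hn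
  rw [G.finrank_eq_h] at h0
  exact h1.trans h0

/-- The Liouville inequality as a LOWER BOUND: a non-zero algebraic integer all of whose
conjugates are bounded by `B ≥ 1` has `|x| ≥ B^{-(h-1)}`. [cite: Baker1975, Ch. 2 Lemma 3] -/
theorem norm_ge_of_forall_norm_le {x : 𝓞 G.K} (hx : x ≠ 0) {B : ℝ} (hB : 1 ≤ B)
    (hc : ∀ σ : G.K →+* ℂ, ‖σ (x : G.K)‖ ≤ B) : (B ^ (G.h - 1))⁻¹ ≤ ‖((x : G.K) : ℂ)‖ := by
  have h1 := G.one_le_norm_mul_house_pow hx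
  have hh : house (x : G.K) ≤ B := G.house_le_of_forall_norm_le (zero_le_one.trans hB) hc
  have hBpos : 0 < B ^ (G.h - 1) := pow_pos (lt_of_lt_of_le zero_lt_one hB) _
  have h2 : house (x : G.K) ^ (G.h - 1) ≤ B ^ (G.h - 1) :=
    pow_le_pow_left₀ (house_nonneg _) hh _
  rw [inv_le_iff_one_le_mul₀ hBpos]
  calc (1 : ℝ) ≤ ‖((x : G.K) : ℂ)‖ * house (x : G.K) ^ (G.h - 1) := h1
    _ ≤ ‖((x : G.K) : ℂ)‖ * B ^ (G.h - 1) := mul_le_mul_of_nonneg_left h2 (norm_nonneg _)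

end AlgGens

end Literature.NumberTheory.Transcendental

end
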